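import Summits.NavierStokesRegularity.NavierStokesRegularity.Theorems.ExtremiserTransienceLocalMaximiserVariations
import HarnessLib

/-!
# Route `ExtremiserTransience`, crux `NearExtremalTransiencePerFlow` (stmt-NavierStokesRegularity-26567):
# EULER–LAGRANGE in the limit class and the LAYER FORMULAS of the amplitude tests
# (Theorems-side PORT of LINE g9-1 «local_maximiser» §2/§3d/§3g, ns-idea-10 g9, PROVED there; needed BY NAME by LINE g10-1
# «two_thirds» stub S2 `FirstOrderIdentity`)

Verbatim port (namespace and three lemma names adapted as in `…LocalMaximiserVariations`) of the kernel-checked parts of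
`Cruxes/NearExtremalTransience/Lines/local_maximiser.lean` REV 3.8 (ns-idea-10 g9 — all credit there) that LINE g10-1 «two_thirds»
(ns-idea-10 g10) names as the inputs of its stub S2 (card `Lines/two_thirds.md`: «Leans on: g9's `eulerLagrange_holds`, `a1_layer`,
`a1_eq_integral_f1` … to be ported Theorems-side with the stub»):

* `noPlateau_of_linearGrowth` — an analytic field with linear energy growth has no speed plateau (§2);
* `a1_eq_split`, `eulerLagrange_holds` — the Euler–Lagrange identity `a₁(curl η) = 0` across a thin contact set (§3d; the tree's
  continuous density `KStar.exists_density` + the fundamental lemma), and `eulerLagrange_of_inLimitClass` (thin contact set is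
  automatic in the limit class);
* the plateau calculus (§3g): `sd/zd/wd_const_smul`, `gainIntegrand_smul_neg`, `coeff_match`, `plateau_densities`, the densities
  `f1`, `f2` with `a1_eq_integral_f1`, `a2_eq_integral_f2`, and the LAYER FORMULAS `a1_layer`, `a2_layer`.

HONEST FRAMING: calculus lemmas about smooth/analytic vector fields; nothing about Navier–Stokes regularity or blow-up is proved; the
crux ⟨26567⟩ and NS regularity are OPEN; no summit is proved by a line. [folklore]
-/

noncomputable section

open scoped Topology InnerProductSpace RealInnerProductSpace ENNReal ContDiff
open MeasureTheory Filter Set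
open Literature.Analysis.FluidPDE
open Summit.NavierStokesRegularity.NavierStokesRegularity.Theorems.DepletionLadder.KStar.HalfSpace
open Summit.NavierStokesRegularity.NavierStokesRegularity.Theorems.DepletionLadder.KStar.BangBang
open Summit.NavierStokesRegularity.NavierStokesRegularity.Theorems.DepletionLadder

namespace Summit.NavierStokesRegularity.NavierStokesRegularity.Theorems.NearExtremalTransiencePerFlow.LocalMaximiser

-- the summit's namespace repeats the problem name by convention (D-0017)
set_option linter.dupNamespace false

/-! ## No speed plateau under linear growth (port of §2) -/

/-- **PLATEAU BRANCH, PROVED.** An analytic field with a speed plateau (`‖V‖ = 1` on a non-empty open set) has `‖V‖ ≡ 1`,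
hence cubic local energy growth — incompatible with linear growth. [folklore] -/
theorem noPlateau_of_linearGrowth {V : E3 → E3} {A_E : ℝ} (han : AnalyticOnNhd ℝ V univ)
    (hgr : HasLinearGrowth A_E V) (hpl : (interior {x : E3 | ‖V x‖ = 1}).Nonempty) : False := by
  obtain ⟨x₀, hx₀⟩ := hpl
  -- `‖V‖² = Σᵢ Vᵢ²` is analytic
  have hsq : AnalyticOnNhd ℝ (fun x => ‖V x‖ ^ 2) univ := by
    have hcoord : ∀ i : Fin 3, AnalyticOnNhd ℝ (fun x => V x i) univ := fun i =>
      (EuclideanSpace.proj i : EuclideanSpace ℝ (Fin 3) →L[ℝ] ℝ).comp_analyticOnNhd han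
    have heq : (fun x => ‖V x‖ ^ 2) = fun x => ∑ i, V x i * V x i := by
      funext x
      rw [EuclideanSpace.norm_eq, Real.sq_sqrt (Finset.sum_nonneg fun i _ => sq_nonneg _)]
      exact Finset.sum_congr rfl fun i _ => by rw [Real.norm_eq_abs, sq_abs, sq]
    rw [heq]
    exact Finset.analyticOnNhd_fun_sum _ fun i _ => (hcoord i).mul (hcoord i)
  have hev : (fun x => ‖V x‖ ^ 2) =ᶠ[𝓝 x₀] fun _ => (1 : ℝ) := by
    filter_upwards [mem_interior_iff_mem_nhds.1 hx₀] with x hx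
    have hx' : ‖V x‖ = 1 := hx
    rw [hx', one_pow]
  have hconst : (fun x => ‖V x‖ ^ 2) = fun _ => (1 : ℝ) := hsq.eq_of_eventuallyEq analyticOnNhd_const hev
  have hone : ∀ x, ‖V x‖ ^ 2 = 1 := fun x => congrFun hconst x
  -- the unit ball has positive finite volume `b`; `vol B(0,R) = R³ b`
  set b : ℝ := (volume (Metric.ball (0 : E3) 1)).toReal with hb
  have hbpos : 0 < b := by
    rw [hb]
    refine ENNReal.toReal_pos (Metric.measure_ball_pos volume (0 : E3) one_pos).ne' measure_ball_lt_top.ne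
  have hvolR : ∀ R : ℝ, 0 < R → (volume (Metric.ball (0 : E3) R)).toReal = R ^ 3 * b := by
    intro R hR
    rw [Measure.addHaar_ball_of_pos volume (0 : E3) hR, ENNReal.toReal_mul, finrank_euclideanSpace,
      Fintype.card_fin, ENNReal.toReal_ofReal (by positivity), hb]
  -- energy of `B(0,R)` equals its volume
  have hener : ∀ R : ℝ, 0 < R → ∫ y in Metric.ball (0 : E3) R, ‖V y‖ ^ 2 = R ^ 3 * b := by
    intro R hR
    rw [← hvolR R hR]
    simp_rw [hone]
    rw [setIntegral_const, smul_eq_mul, mul_one]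
    rfl
  -- take `R` with `R² b > A_E`
  have hAE : 0 ≤ A_E := by
    have h := hgr 0 1 one_pos
    rw [hener 1 one_pos] at h
    nlinarith
  set R : ℝ := Real.sqrt (A_E / b) + 1 with hR
  have hRpos : 0 < R := by rw [hR]; positivity
  have hge : Real.sqrt (A_E / b) ^ 2 = A_E / b := Real.sq_sqrt (div_nonneg hAE hbpos.le)
  have hmain := hgr 0 R hRpos
  rw [hener R hRpos] at hmain
  -- `R³ b ≤ A_E R` contradicts `R² b > A_E`
  have hR2 : A_E < R ^ 2 * b := by
    have : A_E = (A_E / b) * b := by field_simp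
    rw [this, ← hge]
    have hs : 0 ≤ Real.sqrt (A_E / b) := Real.sqrt_nonneg _
    have hlt : Real.sqrt (A_E / b) ^ 2 < R ^ 2 := by
      rw [hR]; nlinarith
    exact mul_lt_mul_of_pos_right hlt hbpos
  have : R ^ 3 * b = R * (R ^ 2 * b) := by ring
  rw [this] at hmain
  have h2 : R * (R ^ 2 * b) > R * A_E := mul_lt_mul_of_pos_left hR2 hRpos
  linarith

/-! ## Euler–Lagrange across a thin contact set (port of §3d) -/

section EulerLagrangeProof

variable {V : E3 → E3}

/-- `a₁ = ∫c₁ − (κ/μ)∫z₁ − κμ∫w₁` on a smooth compactly supported direction. [folklore] -/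
theorem a1_eq_split {κ μ : ℝ} (hV : ContDiff ℝ (⊤ : ℕ∞) V) {φ : E3 → E3} (hφ : ContDiff ℝ (⊤ : ℕ∞) φ)
    (hφc : HasCompactSupport φ) :
    a1 κ μ V φ = 1 * (∫ x, c1 V φ x) + -(κ * μ⁻¹) * (∫ x, z1 V φ x) + -(κ * μ) * (∫ x, w1 V φ x) := by
  have ic1 : Integrable (fun x => c1 V φ x) := (KStar.integrable_stretching_coeffs hV hφ hφc).1
  have iz1 : Integrable (fun x => κ * μ⁻¹ * z1 V φ x) := (KStar.integrable_enstrophy_coeffs hV hφ hφc).1.const_mul _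
  have iw1 : Integrable (fun x => κ * μ * w1 V φ x) := (KStar.integrable_palinstrophy_coeffs hV hφ hφc).1.const_mul _
  have i12 : Integrable (fun x => c1 V φ x - κ * μ⁻¹ * z1 V φ x) := ic1.sub iz1
  have hpt : (fun x => c1 V φ x - (κ / 2) * (μ⁻¹ * (2 * z1 V φ x) + μ * (2 * w1 V φ x))) =
      fun x => c1 V φ x - κ * μ⁻¹ * z1 V φ x - κ * μ * w1 V φ x := by
    funext x; ring
  unfold a1
  rw [hpt, integral_sub i12 iw1, integral_sub ic1 iz1, integral_const_mul, integral_const_mul]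
  ring

/-- **EULER–LAGRANGE ACROSS A THIN CONTACT SET (L4e of LINE g9-1, PROVED there; ported).**  In the limit class, if the contact
set `{‖V‖ = 1}` has empty interior, the first variation of `F̃` vanishes on the curl of every smooth compactly supported potential:
`a₁(curl η) = 0`.  (The body of the line's `Sig.EulerLagrange`, verbatim.) -/
theorem eulerLagrange_holds :
    ∀ (A : ℕ → ℝ) (A_E : ℝ) (V : E3 → E3), InLimitClass A A_E V → interior {x : E3 | ‖V x‖ = 1} = ∅ →
      ∀ η : E3 → E3, ContDiff ℝ (⊤ : ℕ∞) η → HasCompactSupport η → a1 kStar 1 V (curl η) = 0 := by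
  intro A A_E V hV hK η hη hηc
  have hVs : ContDiff ℝ (⊤ : ℕ∞) V := hV.2.1
  have hle : ∀ x, ‖V x‖ ≤ 1 := hV.2.2.2.1
  have hmax : IsLocMax kStar 1 V := isLocMax_of_isLocMaxIn hVs hV.2.2.2.2.2.2
  -- the off-contact set `U = {‖V‖ < 1}` is open and dense
  have hUo : IsOpen {x : E3 | ‖V x‖ < 1} := isOpen_lt (continuous_norm.comp hVs.continuous) continuous_const
  have hUeq : ({x : E3 | ‖V x‖ = 1})ᶜ = {x : E3 | ‖V x‖ < 1} := by
    ext x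
    simp only [mem_compl_iff, mem_setOf_eq]
    exact ⟨fun h => lt_of_le_of_ne (hle x) h, fun h => ne_of_lt h⟩
  have hne : Dense {x : E3 | ‖V x‖ < 1} := by
    rw [← hUeq, ← interior_eq_empty_iff_dense_compl]
    exact hK
  -- the continuous density of `a₁ ∘ curl`
  obtain ⟨G, hGc, hG⟩ := KStar.exists_density hVs 1 (-(kStar * (1 : ℝ)⁻¹)) (-(kStar * 1))
  have hrep : ∀ η : E3 → E3, ContDiff ℝ (⊤ : ℕ∞) η → HasCompactSupport η →
      a1 kStar 1 V (curl η) = ∫ x, ⟪G x, η x⟫_ℝ := by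
    intro η hη hηc
    rw [a1_eq_split hVs (contDiff_curl_top hη) (hasCompactSupport_curl hηc), ← hG η hη hηc]
    rfl
  have hℓ0 : ∀ η : E3 → E3, ContDiff ℝ (⊤ : ℕ∞) η → HasCompactSupport η →
      tsupport η ⊆ {x : E3 | ‖V x‖ < 1} → ∫ x, ⟪G x, η x⟫_ℝ = 0 := by
    intro η hη hηc hηU
    rw [← hrep η hη hηc]
    exact (firstSecondOrder_of_strict hVs hmax (contDiff_curl_top hη) (hasCompactSupport_curl hηc)
      (isDivFree_curl hη) (fun x hx => hηU (tsupport_curl_subset η hx))).1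
  -- `G = 0` a.e. on `U` (fundamental lemma), hence on `U`, hence everywhere by density and continuity
  have hGae : ∀ᵐ x ∂(volume : Measure E3), x ∈ {x : E3 | ‖V x‖ < 1} → G x = 0 := by
    refine hUo.ae_eq_zero_of_integral_contDiff_smul_eq_zero (hGc.locallyIntegrable.locallyIntegrableOn _)
      fun θ hθ hθc hθU => ?_
    have hint : Integrable (fun x => θ x • G x) (volume : Measure E3) :=
      (hθ.continuous.smul hGc).integrable_of_hasCompactSupport hθc.smul_right
    refine ext_inner_left ℝ fun e => ?_
    rw [inner_zero_right, ← integral_inner hint e]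
    have hη : ContDiff ℝ ∞ fun x => θ x • e := hθ.smul contDiff_const
    have hηc : HasCompactSupport fun x => θ x • e := hθc.smul_right
    have hηU : tsupport (fun x => θ x • e) ⊆ {x : E3 | ‖V x‖ < 1} := (tsupport_smul_subset_left _ _).trans hθU
    have hpt : ∀ x, ⟪e, θ x • G x⟫_ℝ = ⟪G x, θ x • e⟫_ℝ := fun x => by
      rw [inner_smul_right, inner_smul_right, real_inner_comm]
    rw [integral_congr_ae (Eventually.of_forall hpt)]
    exact hℓ0 _ hη hηc hηU
  have hGU : EqOn G 0 {x : E3 | ‖V x‖ < 1} :=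
    Measure.eqOn_open_of_ae_eq ((ae_restrict_iff' hUo.measurableSet).2 hGae) hUo hGc.continuousOn
      continuousOn_const
  have hG0 : G = 0 := Continuous.ext_on hne hGc continuous_const hGU
  rw [hrep η hη hηc, hG0]
  simp

end EulerLagrangeProof

/-- **EULER–LAGRANGE IN THE LIMIT CLASS, UNCONDITIONALLY.**  The empty-interior hypothesis of `eulerLagrange_holds` is automatic
in the limit class (analyticity + linear growth: `noPlateau_of_linearGrowth`). [folklore] -/
theorem eulerLagrange_of_inLimitClass {A : ℕ → ℝ} {A_E : ℝ} {V : E3 → E3} (hV : InLimitClass A A_E V)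
    {η : E3 → E3} (hη : ContDiff ℝ (⊤ : ℕ∞) η) (hηc : HasCompactSupport η) : a1 kStar 1 V (curl η) = 0 := by
  refine eulerLagrange_holds A A_E V hV ?_ η hη hηc
  by_contra hne
  exact noPlateau_of_linearGrowth hV.1 hV.2.2.2.2.2.1 (Set.nonempty_iff_ne_empty.2 hne)

/-! ## Plateau calculus: the layer formulas (port of §3g) -/

section Plateau

variable {V φ : E3 → E3}

/-- cubic homogeneity of the stretching density. [folklore] -/
theorem sd_const_smul (hV : ContDiff ℝ (⊤ : ℕ∞) V) (c : ℝ) (x : E3) :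
    sd (fun y => c • V y) x = c ^ 3 * sd V x := by
  have hVd : Differentiable ℝ V := hV.differentiable (by simp)
  unfold sd
  rw [curl_const_smul (hVd x), fderiv_fun_const_smul (hVd x)]
  simp only [smul_apply, map_smul, real_inner_smul_left, real_inner_smul_right]
  ring

/-- quadratic homogeneity of the enstrophy density. [folklore] -/
theorem zd_const_smul (hV : ContDiff ℝ (⊤ : ℕ∞) V) (c : ℝ) (x : E3) :
    zd (fun y => c • V y) x = c ^ 2 * zd V x := by
  have hVd : Differentiable ℝ V := hV.differentiable (by simp)
  unfold zd
  rw [curl_const_smul (hVd x), norm_smul, mul_pow, Real.norm_eq_abs, sq_abs]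

/-- quadratic homogeneity of the palinstrophy density. [folklore] -/
theorem wd_const_smul (hV : ContDiff ℝ (⊤ : ℕ∞) V) (c : ℝ) (x : E3) :
    wd (fun y => c • V y) x = c ^ 2 * wd V x := by
  have hVd : Differentiable ℝ V := hV.differentiable (by simp)
  have hcV : ContDiff ℝ 1 (curl V) := contDiff_curl (n := 1) (hV.of_le (by norm_cast))
  have hcd : Differentiable ℝ (curl V) := hcV.differentiable (by norm_num)
  have hfun : curl (fun y => c • V y) = fun y => c • curl V y := funext fun y => curl_const_smul (hVd y) c
  unfold wd
  rw [hfun, fderiv_fun_const_smul (hcd x)]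
  simp only [frobeniusNormSq, smul_apply, norm_smul, mul_pow, Real.norm_eq_abs, sq_abs,
    Finset.mul_sum]

/-- The gain integrand along the pure amplitude direction `−V`: an explicit cubic in `s`. [folklore] -/
theorem gainIntegrand_smul_neg (hV : ContDiff ℝ (⊤ : ℕ∞) V) (κ μ s : ℝ) (x : E3) :
    gainIntegrand κ μ V (s • fun y => -V y) x =
      ((1 - s) ^ 3 - 1) * sd V x - (κ / 2) * (μ⁻¹ * (((1 - s) ^ 2 - 1) * zd V x) + μ * (((1 - s) ^ 2 - 1) * wd V x)) := by
  have hW : (V + s • fun y => -V y) = fun y => (1 - s) • V y := by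
    funext y
    simp only [Pi.add_apply, Pi.smul_apply, smul_neg, sub_smul, one_smul]
    abel
  unfold gainIntegrand
  rw [hW, sd_const_smul hV, zd_const_smul hV, wd_const_smul hV]
  ring

/-- Matching a cubic through the origin at `s = 1, −1, 2` determines its first two coefficients. -/
theorem coeff_match {A B C A' B' C' : ℝ}
    (h : ∀ s : ℝ, s * A + s ^ 2 * B + s ^ 3 * C = s * A' + s ^ 2 * B' + s ^ 3 * C') : A = A' ∧ B = B' := by
  have h1 := h 1; have h2 := h (-1); have h3 := h 2
  constructor <;> nlinarith [h1, h2, h3]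

/-- **FIRST- AND SECOND-ORDER DENSITIES ON THE PLATEAU.**  If `φ` agrees with `−V` near `x`, the first Taylor coefficient
density of the gain is `−3·sd + κ(μ⁻¹ zd + μ wd)` and the second is `3·sd − (κ/2)(μ⁻¹ zd + μ wd)` at `x`. [folklore] -/
theorem plateau_densities (hV : ContDiff ℝ (⊤ : ℕ∞) V) (hφ : ContDiff ℝ (⊤ : ℕ∞) φ) {κ μ : ℝ} {x : E3}
    (h : φ =ᶠ[𝓝 x] fun y => -V y) :
    c1 V φ x - (κ / 2) * (μ⁻¹ * (2 * z1 V φ x) + μ * (2 * w1 V φ x)) = -3 * sd V x + κ * (μ⁻¹ * zd V x + μ * wd V x) ∧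
      c2 V φ x - (κ / 2) * (μ⁻¹ * zd φ x + μ * wd φ x) = 3 * sd V x - (κ / 2) * (μ⁻¹ * zd V x + μ * wd V x) := by
  -- germ transfer: the gain integrand of `s•φ` at `x` equals that of `s•(−V)`
  have hgerm : ∀ s : ℝ, gainIntegrand κ μ V (s • φ) x = gainIntegrand κ μ V (s • fun y => -V y) x := by
    intro s
    have hs : (V + s • φ) =ᶠ[𝓝 x] (V + s • fun y => -V y) :=
      h.mono fun y hy => by simp only [Pi.add_apply, Pi.smul_apply, hy]
    unfold gainIntegrand
    rw [sd_congr_nhds hs, zd_congr_nhds hs, wd_congr_nhds hs]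
  have hpoly : ∀ s : ℝ,
      s * (c1 V φ x - (κ / 2) * (μ⁻¹ * (2 * z1 V φ x) + μ * (2 * w1 V φ x))) +
          s ^ 2 * (c2 V φ x - (κ / 2) * (μ⁻¹ * zd φ x + μ * wd φ x)) + s ^ 3 * c3 φ x =
        s * (-3 * sd V x + κ * (μ⁻¹ * zd V x + μ * wd V x)) +
          s ^ 2 * (3 * sd V x - (κ / 2) * (μ⁻¹ * zd V x + μ * wd V x)) + s ^ 3 * (-sd V x) := by
    intro s
    rw [← gainIntegrand_smul hV hφ s x, hgerm s, gainIntegrand_smul_neg hV κ μ s x]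
    ring
  exact coeff_match hpoly

variable (V φ) in
/-- the first Taylor coefficient density of the local gain with `κ = κ⋆`, `μ = 1` (the integrand of `a1 kStar 1 V φ`). -/
def f1 (x : E3) : ℝ := c1 V φ x - (kStar / 2) * ((1 : ℝ)⁻¹ * (2 * z1 V φ x) + 1 * (2 * w1 V φ x))

variable (V φ) in
/-- the second Taylor coefficient density of the local gain with `κ = κ⋆`, `μ = 1` (the integrand of `a2 kStar 1 V φ`). -/
def f2 (x : E3) : ℝ := c2 V φ x - (kStar / 2) * ((1 : ℝ)⁻¹ * zd φ x + 1 * wd φ x)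

/-- `a₁(φ)` (with `κ = κ⋆`, `μ = 1`) is the integral of the density `f1` (definitional). -/
theorem a1_eq_integral_f1 : a1 kStar 1 V φ = ∫ x, f1 V φ x := rfl

/-- `a₂(φ)` (with `κ = κ⋆`, `μ = 1`) is the integral of the density `f2` (definitional). -/
theorem a2_eq_integral_f2 : a2 kStar 1 V φ = ∫ x, f2 V φ x := rfl

/-- **FIRST-ORDER LAYER FORMULA.**  For smooth compactly supported `φ` equal to `−V` on an open set `P` on which the continuous
compactly supported weight `χ` equals `1`, the first-order defect of `HasAmplitudeTests` is an integral over the layer `Pᶜ`: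
`a₁(φ) + (3J_{χ²} − 2K_{χ²}) = ∫_{Pᶜ} (f₁ + χ²(3·sd − κ⋆(zd + wd)))`. [folklore] -/
theorem a1_layer (hV : ContDiff ℝ (⊤ : ℕ∞) V) (hφ : ContDiff ℝ (⊤ : ℕ∞) φ) (hφc : HasCompactSupport φ) {χ : E3 → ℝ}
    (hχ : Continuous χ) (hχc : HasCompactSupport χ) {P : Set E3} (hP : IsOpen P) (hχP : ∀ x ∈ P, χ x = 1)
    (hφP : ∀ x ∈ P, φ x = -V x) :
    a1 kStar 1 V φ + (3 * Jg χ V - 2 * Kg χ V) =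
      ∫ x in Pᶜ, (f1 V φ x + χ x ^ 2 * (3 * sd V x - kStar * (zd V x + wd V x))) := by
  have ic1 : Integrable (c1 V φ) := (KStar.integrable_stretching_coeffs hV hφ hφc).1
  have iz1 : Integrable (z1 V φ) := (KStar.integrable_enstrophy_coeffs hV hφ hφc).1
  have iw1 : Integrable (w1 V φ) := (KStar.integrable_palinstrophy_coeffs hV hφ hφc).1
  have if1 : Integrable (f1 V φ) :=
    ic1.sub ((((iz1.const_mul 2).const_mul (1 : ℝ)⁻¹).add ((iw1.const_mul 2).const_mul 1)).const_mul (kStar / 2))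
  -- the weighted bulk densities are continuous with compact support
  have hg_cont : Continuous fun x => χ x ^ 2 * (3 * sd V x - kStar * (zd V x + wd V x)) :=
    (hχ.pow 2).mul ((continuous_const.mul (continuous_sd' hV)).sub
      (continuous_const.mul ((continuous_zd' hV).add (continuous_wd' hV))))
  have hg_supp : HasCompactSupport fun x => χ x ^ 2 * (3 * sd V x - kStar * (zd V x + wd V x)) := by
    refine HasCompactSupport.intro hχc fun x hx => ?_
    simp [image_eq_zero_of_notMem_tsupport hx]
  have ig : Integrable fun x => χ x ^ 2 * (3 * sd V x - kStar * (zd V x + wd V x)) :=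
    hg_cont.integrable_of_hasCompactSupport hg_supp
  have hJ_cont : Continuous fun x => χ x ^ 2 * sd V x := (hχ.pow 2).mul (continuous_sd' hV)
  have hJ_supp : HasCompactSupport fun x => χ x ^ 2 * sd V x := by
    refine HasCompactSupport.intro hχc fun x hx => ?_
    simp [image_eq_zero_of_notMem_tsupport hx]
  have iJ : Integrable fun x => χ x ^ 2 * sd V x := hJ_cont.integrable_of_hasCompactSupport hJ_supp
  have hK_cont : Continuous fun x => χ x ^ 2 * (zd V x + wd V x) := (hχ.pow 2).mul ((continuous_zd' hV).add (continuous_wd' hV))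
  have hK_supp : HasCompactSupport fun x => χ x ^ 2 * (zd V x + wd V x) := by
    refine HasCompactSupport.intro hχc fun x hx => ?_
    simp [image_eq_zero_of_notMem_tsupport hx]
  have iK : Integrable fun x => χ x ^ 2 * (zd V x + wd V x) := hK_cont.integrable_of_hasCompactSupport hK_supp
  -- pointwise: the combined integrand vanishes on the plateau
  have hzero : ∀ x, x ∉ Pᶜ → f1 V φ x + χ x ^ 2 * (3 * sd V x - kStar * (zd V x + wd V x)) = 0 := by
    intro x hx
    have hxP : x ∈ P := not_notMem.1 hx
    have hgerm : φ =ᶠ[𝓝 x] fun y => -V y :=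
      Filter.eventually_of_mem (hP.mem_nhds hxP) fun y hy => hφP y hy
    have h1 := (plateau_densities hV hφ (κ := kStar) (μ := 1) hgerm).1
    unfold f1
    rw [h1, hχP x hxP]
    ring
  rw [setIntegral_eq_integral_of_forall_compl_eq_zero hzero, integral_add if1 ig]
  have eg : (fun x => χ x ^ 2 * (3 * sd V x - kStar * (zd V x + wd V x))) =
      fun x => 3 * (χ x ^ 2 * sd V x) - kStar * (χ x ^ 2 * (zd V x + wd V x)) := by
    funext x; ring
  rw [eg, integral_sub (iJ.const_mul 3) (iK.const_mul kStar), integral_const_mul, integral_const_mul]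
  unfold Jg Kg
  rw [a1_eq_integral_f1]
  ring

/-- **SECOND-ORDER LAYER FORMULA.**  Same setting: `a₂(φ) − (3J_{χ²} − K_{χ²}) = ∫_{Pᶜ} (f₂ − χ²(3·sd − (κ⋆/2)(zd + wd)))`.
[folklore] -/
theorem a2_layer (hV : ContDiff ℝ (⊤ : ℕ∞) V) (hφ : ContDiff ℝ (⊤ : ℕ∞) φ) (hφc : HasCompactSupport φ) {χ : E3 → ℝ}
    (hχ : Continuous χ) (hχc : HasCompactSupport χ) {P : Set E3} (hP : IsOpen P) (hχP : ∀ x ∈ P, χ x = 1)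
    (hφP : ∀ x ∈ P, φ x = -V x) :
    a2 kStar 1 V φ - (3 * Jg χ V - Kg χ V) =
      ∫ x in Pᶜ, (f2 V φ x - χ x ^ 2 * (3 * sd V x - kStar / 2 * (zd V x + wd V x))) := by
  have ic2 : Integrable (c2 V φ) := (KStar.integrable_stretching_coeffs hV hφ hφc).2.1
  have izd : Integrable (zd φ) := (KStar.integrable_enstrophy_coeffs hV hφ hφc).2
  have iwd : Integrable (wd φ) := (KStar.integrable_palinstrophy_coeffs hV hφ hφc).2
  have if2 : Integrable (f2 V φ) :=
    ic2.sub (((izd.const_mul (1 : ℝ)⁻¹).add (iwd.const_mul 1)).const_mul (kStar / 2))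
  have hg_cont : Continuous fun x => χ x ^ 2 * (3 * sd V x - kStar / 2 * (zd V x + wd V x)) :=
    (hχ.pow 2).mul ((continuous_const.mul (continuous_sd' hV)).sub
      (continuous_const.mul ((continuous_zd' hV).add (continuous_wd' hV))))
  have hg_supp : HasCompactSupport fun x => χ x ^ 2 * (3 * sd V x - kStar / 2 * (zd V x + wd V x)) := by
    refine HasCompactSupport.intro hχc fun x hx => ?_
    simp [image_eq_zero_of_notMem_tsupport hx]
  have ig : Integrable fun x => χ x ^ 2 * (3 * sd V x - kStar / 2 * (zd V x + wd V x)) :=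
    hg_cont.integrable_of_hasCompactSupport hg_supp
  have hJ_cont : Continuous fun x => χ x ^ 2 * sd V x := (hχ.pow 2).mul (continuous_sd' hV)
  have hJ_supp : HasCompactSupport fun x => χ x ^ 2 * sd V x := by
    refine HasCompactSupport.intro hχc fun x hx => ?_
    simp [image_eq_zero_of_notMem_tsupport hx]
  have iJ : Integrable fun x => χ x ^ 2 * sd V x := hJ_cont.integrable_of_hasCompactSupport hJ_supp
  have hK_cont : Continuous fun x => χ x ^ 2 * (zd V x + wd V x) := (hχ.pow 2).mul ((continuous_zd' hV).add (continuous_wd' hV))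
  have hK_supp : HasCompactSupport fun x => χ x ^ 2 * (zd V x + wd V x) := by
    refine HasCompactSupport.intro hχc fun x hx => ?_
    simp [image_eq_zero_of_notMem_tsupport hx]
  have iK : Integrable fun x => χ x ^ 2 * (zd V x + wd V x) := hK_cont.integrable_of_hasCompactSupport hK_supp
  have hzero : ∀ x, x ∉ Pᶜ → f2 V φ x - χ x ^ 2 * (3 * sd V x - kStar / 2 * (zd V x + wd V x)) = 0 := by
    intro x hx
    have hxP : x ∈ P := not_notMem.1 hx
    have hgerm : φ =ᶠ[𝓝 x] fun y => -V y :=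
      Filter.eventually_of_mem (hP.mem_nhds hxP) fun y hy => hφP y hy
    have h2 := (plateau_densities hV hφ (κ := kStar) (μ := 1) hgerm).2
    unfold f2
    rw [h2, hχP x hxP]
    simp
  rw [setIntegral_eq_integral_of_forall_compl_eq_zero hzero, integral_sub if2 ig]
  have eg : (fun x => χ x ^ 2 * (3 * sd V x - kStar / 2 * (zd V x + wd V x))) =
      fun x => 3 * (χ x ^ 2 * sd V x) - kStar / 2 * (χ x ^ 2 * (zd V x + wd V x)) := by
    funext x; ring
  rw [eg, integral_sub (iJ.const_mul 3) (iK.const_mul (kStar / 2)), integral_const_mul, integral_const_mul]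
  unfold Jg Kg
  rw [a2_eq_integral_f2]

end Plateau

end Summit.NavierStokesRegularity.NavierStokesRegularity.Theorems.NearExtremalTransiencePerFlow.LocalMaximiser

end
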